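import Summits.HubbardSuperconductivity.HubbardSuperconductivity.Theorems.MesoscopicPairOrder.Negative.StonerSquareSea
import Summits.HubbardSuperconductivity.HubbardSuperconductivity.Theorems.MesoscopicPairOrder.Negative.StonerExactDoublon
import Literature.Analysis.Fourier.SquareWaveSineSeries
import Literature.MathematicalPhysics.QuantumLattice.TorusBandEdgeCounting
import HarnessLib

/-!
# Crux `MesoscopicPairOrder` (stmt-HubbardSuperconductivity-7331), Negative side:
# the momentum DIAMOND as a trial Fermi sea — exact Dirichlet + Fejér kinetic sum

Line `redirect_birth` (lead c11, wave 3), Stoner trial side of `stub_pairFluctuationFloor`. The Stoner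
spin ceilings (`eight_spin_le_of_pairedSea_exact`, `shifted_spin_le_of_pairedSea_exact`: every
duplicate-free list `l` of `n` momenta bounds the spin of a sector ground state through `Σ_{k∈l} ε_L(k)`)
were so far evaluated with the momentum SQUARE (`StonerSquareSea.exists_trialSet_card_eq`), which falls
short of the free Fermi sea, whose Fermi surface near half filling is the rounded diamond
`|k_x| + |k_y| ≈ π`. This file lands the DIAMOND `D_h = {(u, v) ∈ ℤ² : |u| + |v| ≤ h}` (`2h² + 2h + 1`
momenta, distinct residues in `(ℤ/Lℤ)²` once `2h + 1 ≤ L`) with its band energy in closed form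
(`θ = 2π/L`, `x = π/L`, `D_j = Σ_{|u| ≤ j} cos(uθ) = sin((2j+1)x)/sin x` the Dirichlet kernel):

  `Σ_{k ∈ D_h} ε_L(k) = -4 Σ_{(u,v) ∈ D_h} cos(vθ) = -4 (D_h + 2 Σ_{j<h} D_j)`,
  `Σ_{j<h} D_j = sin²(hx)/sin²x ≥ (L/π)² sin²(hπ/L)`,  `D_h ≥ (L/π) sin((2h+1)π/L)`

(the first equality is the `u ↔ v` symmetry of the diamond, the second counts the rows
`|v| ≤ h - |u|`; the Fejér identity `sin x · Σ_{j<h} sin((2j+1)x) = sin²(hx)` is the tree's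
`Literature.Analysis.Fourier.sin_mul_sum_sin_odd`, `Σ_{j<h} (2j+1) = h²` is
`TorusBandEdgeCounting.sum_range_two_mul_add_one`, and `0 < sin x ≤ x`). Proved here:

* `sin_mul_dirichlet_sum_eq` — `sin(π/L) · Σ_{u<2j+1} cos(2π(u-j)/L) = sin((2j+1)π/L)` (exact Dirichlet
  sum);
* `sq_mul_sin_sq_le_sum_dirichlet_sum` — `(L/π)² sin²(hπ/L) ≤ Σ_{j<h} Σ_{u<2j+1} cos(2π(u-j)/L)`
  (`L ≥ 3`);
* `sum_range_two_mul_add_one_min` — the row bookkeeping `Σ_{a<2h+1} g(min(a, 2h-a)) = 2Σ_{j<h} g j + g h`;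
* `exists_diamondTrialSet_card_eq` — for `L ≥ 3`, `2h+1 ≤ L`, `2h²+2h+1 ≤ n ≤ L²`: a momentum set of
  EXACTLY `n` elements (diamond plus `n - (2h²+2h+1)` arbitrary momenta, each costing `≤ 4`) with
  `Σ ε_L ≤ -4((L/π) sin((2h+1)π/L) + 2(L/π)² sin²(hπ/L)) + 4(n - (2h²+2h+1))`;
* `existsDiamondTrialSet` — its registered sub-goal form;
* `eight_spin_le_of_diamondSea_exact`, `shifted_spin_le_of_diamondSea_exact` — the band-edge and
  shifted Stoner ceilings with the exact doublon density (`StonerExactDoublon`), fed with the diamond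
  sea (general `h`, no numerics).

Asymptotically (`L → ∞`, `2h/L → s`) the diamond's band energy is `-(8/π²) sin²(πs/2) L² + O(L)`; at
pair filling `n/L² ≈ s²/2 = 2/5` (`δ = 1/5`) this is `≈ -0.79 L²`, essentially the free Fermi-sea value
quoted in `StonerSquareSea`, against the square's `≈ -0.72 L²`.

Sources: E. M. Stein, R. Shakarchi, *Fourier Analysis* (2003), Ch. 2 §5 (Dirichlet and Fejér kernels);
E. C. Stoner, Proc. R. Soc. A 165 (1938) 372; D. R. Penn, Phys. Rev. 142 (1966) 350, §II. Folklore
finite sums; no definition, no named fact, no sorry.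
-/

noncomputable section

-- the summit namespace repeats the problem name by design (D-0017)
set_option linter.dupNamespace false

namespace Summit.HubbardSuperconductivity.HubbardSuperconductivity.Theorems.MesoscopicPairOrder.Negative

open Matrix Finset Filter
open Literature.Probability.LatticeModels Literature.MathematicalPhysics.QuantumLattice
open scoped ComplexOrder ComplexConjugate

section DirichletFejer

/-! ### One-dimensional sums: exact Dirichlet kernel and the Fejér lower bound -/

/-- **Exact centred Dirichlet sum**: `sin(π/L) · Σ_{u < 2j+1} cos(2π(u - j)/L) = sin((2j+1)π/L)`
(telescoping, `two_sin_mul_sum_cos` at `θ = 2π/L`). Stein–Shakarchi Ch. 2 §5. [folklore] -/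
theorem sin_mul_dirichlet_sum_eq (L j : ℕ) :
    Real.sin (Real.pi / L) * ∑ u ∈ Finset.range (2 * j + 1), Real.cos (2 * Real.pi * ((u : ℝ) - j) / L) =
      Real.sin ((2 * j + 1 : ℕ) * Real.pi / L) := by
  have htel := two_sin_mul_sum_cos (2 * Real.pi / L) j (2 * j + 1)
  have hsum : ∑ u ∈ Finset.range (2 * j + 1), Real.cos (2 * Real.pi * ((u : ℝ) - j) / L) =
      ∑ u ∈ Finset.range (2 * j + 1), Real.cos (((u : ℝ) - j) * (2 * Real.pi / L)) := by
    refine Finset.sum_congr rfl fun u _ => ?_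
    congr 1
    ring
  have e1 : (((2 * j + 1 : ℕ) : ℝ) - j - 1 / 2) * (2 * Real.pi / L) = (2 * j + 1 : ℕ) * Real.pi / L := by
    push_cast
    ring
  have e2 : (-(j : ℝ) - 1 / 2) * (2 * Real.pi / L) = -((2 * j + 1 : ℕ) * Real.pi / L) := by
    push_cast
    ring
  have e3 : 2 * Real.pi / L / 2 = Real.pi / L := by ring
  rw [e1, e2, e3, Real.sin_neg, sub_neg_eq_add, ← two_mul, ← hsum] at htel
  linarith

/-- **Fejér lower bound on the stacked Dirichlet sums**: for `L ≥ 3`,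
`(L/π)² sin²(hπ/L) ≤ Σ_{j<h} Σ_{u<2j+1} cos(2π(u - j)/L)`. Indeed the double sum equals
`sin²(hπ/L)/sin²(π/L)` (`sin_mul_dirichlet_sum_eq` and the Fejér identity
`sin x · Σ_{j<h} sin((2j+1)x) = sin²(hx)`), and `0 < sin(π/L) ≤ π/L`. Stein–Shakarchi Ch. 2 §5. [folklore] -/
theorem sq_mul_sin_sq_le_sum_dirichlet_sum {L : ℕ} (hL : 3 ≤ L) (h : ℕ) :
    ((L : ℝ) / Real.pi) ^ 2 * Real.sin (h * Real.pi / L) ^ 2 ≤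
      ∑ j ∈ Finset.range h, ∑ u ∈ Finset.range (2 * j + 1),
        Real.cos (2 * Real.pi * ((u : ℝ) - j) / L) := by
  have hLpos : (0 : ℝ) < L := by exact_mod_cast (show 0 < L by omega)
  have hπ := Real.pi_pos
  have hxpos : 0 < Real.pi / L := by positivity
  have hsinpos : 0 < Real.sin (Real.pi / L) := by
    apply Real.sin_pos_of_pos_of_lt_pi hxpos
    rw [div_lt_iff₀ hLpos]
    have : (3 : ℝ) ≤ L := by exact_mod_cast hL
    nlinarith
  have hsinle : Real.sin (Real.pi / L) ≤ Real.pi / L := Real.sin_le hxpos.le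
  -- `sin x · S = Σ_{j<h} sin((2j+1)x)` and `sin²x · S = sin²(hx)`
  have h1 : Real.sin (Real.pi / L) * ∑ j ∈ Finset.range h, ∑ u ∈ Finset.range (2 * j + 1),
        Real.cos (2 * Real.pi * ((u : ℝ) - j) / L) =
      ∑ j ∈ Finset.range h, Real.sin ((2 * j + 1) * (Real.pi / L)) := by
    rw [Finset.mul_sum]
    refine Finset.sum_congr rfl fun j _ => ?_
    rw [sin_mul_dirichlet_sum_eq L j]
    congr 1
    push_cast
    ring
  have h2 : Real.sin (Real.pi / L) ^ 2 * ∑ j ∈ Finset.range h, ∑ u ∈ Finset.range (2 * j + 1),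
        Real.cos (2 * Real.pi * ((u : ℝ) - j) / L) = Real.sin (h * (Real.pi / L)) ^ 2 := by
    rw [sq (Real.sin (Real.pi / L)), mul_assoc, h1, Literature.Analysis.Fourier.sin_mul_sum_sin_odd]
  have hhx : (h : ℝ) * Real.pi / L = h * (Real.pi / L) := by ring
  have hLπ : (L : ℝ) / Real.pi = (Real.pi / L)⁻¹ := by rw [inv_div]
  rw [hhx, hLπ, inv_pow, ← div_eq_inv_mul]
  have hS_eq : ∑ j ∈ Finset.range h, ∑ u ∈ Finset.range (2 * j + 1),
        Real.cos (2 * Real.pi * ((u : ℝ) - j) / L) =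
      Real.sin (h * (Real.pi / L)) ^ 2 / Real.sin (Real.pi / L) ^ 2 := by
    rw [eq_div_iff (pow_pos hsinpos 2).ne']
    linarith [h2]
  rw [hS_eq]
  apply div_le_div_of_nonneg_left (sq_nonneg _) (pow_pos hsinpos 2)
  exact pow_le_pow_left₀ hsinpos.le hsinle 2

/-! ### Row bookkeeping of the diamond -/

/-- **Rows of the diamond**: as `a` runs over `[0, 2h]` the row half-width `min(a, 2h - a) = h - |a - h|`
takes the value `h` once and every `j < h` twice: `Σ_{a<2h+1} g(min(a, 2h-a)) = Σ_{j<h} g j + Σ_{j≤h} g j`.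
[folklore] -/
theorem sum_range_two_mul_add_one_min {M : Type*} [AddCommMonoid M] (g : ℕ → M) (h : ℕ) :
    ∑ a ∈ Finset.range (2 * h + 1), g (min a (2 * h - a)) =
      ∑ j ∈ Finset.range h, g j + (∑ j ∈ Finset.range h, g j + g h) := by
  rw [← Finset.sum_range_succ, show 2 * h + 1 = h + (h + 1) by ring, Finset.sum_range_add]
  congr 1
  · refine Finset.sum_congr rfl fun a ha => ?_
    rw [Finset.mem_range] at ha
    congr 1
    omega
  · rw [← Finset.sum_range_reflect g (h + 1)]
    refine Finset.sum_congr rfl fun a ha => ?_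
    rw [Finset.mem_range] at ha
    congr 1
    omega

/-- **A row of the diamond is a shifted Dirichlet sum**: for `w ≤ h`,
`Σ_{b ∈ [h-w, h+w]} cos(2π(b - h)/L) = Σ_{u < 2w+1} cos(2π(u - w)/L)`. [folklore] -/
theorem sum_Ico_cos_shift (L : ℕ) {h w : ℕ} (hw : w ≤ h) :
    ∑ b ∈ Finset.Ico (h - w) (h - w + (2 * w + 1)), Real.cos (2 * Real.pi * ((b : ℝ) - h) / L) =
      ∑ u ∈ Finset.range (2 * w + 1), Real.cos (2 * Real.pi * ((u : ℝ) - w) / L) := by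
  rw [Finset.sum_Ico_eq_sum_range, Nat.add_sub_cancel_left]
  refine Finset.sum_congr rfl fun u _ => ?_
  congr 1
  rw [Nat.cast_add, Nat.cast_sub hw]
  ring

end DirichletFejer

section DiamondSea

variable {L : ℕ} [NeZero L]

/-! ### The momentum diamond as a trial Fermi sea -/

/-- **A trial momentum set of exactly `n` elements built on the DIAMOND.** For `L ≥ 3`, `2h + 1 ≤ L` and
`2h² + 2h + 1 ≤ n ≤ L²` there is `T ⊆ (ℤ/Lℤ)²` with `|T| = n` and
`Σ_{k∈T} ε_L(k) ≤ -4((L/π) sin((2h+1)π/L) + 2(L/π)² sin²(hπ/L)) + 4(n - (2h²+2h+1))`: the diamond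
`{(a - h, b - h) : |a - h| + |b - h| ≤ h}` (indexed by `(a, b) ∈ [0, 2h]²`, rows `b ∈ [h - w_a, h + w_a]`,
`w_a = min(a, 2h - a)`), whose band energy is `-4(D_h + 2Σ_{j<h} D_j)` by the `a ↔ b` symmetry and the
row count, plus `n - (2h²+2h+1)` further momenta of band energy `≤ 4` each. [folklore] -/
theorem exists_diamondTrialSet_card_eq (hL : 3 ≤ L) (h : ℕ) (hm : 2 * h + 1 ≤ L) {n : ℕ}
    (hn : 2 * h ^ 2 + 2 * h + 1 ≤ n) (hnL : n ≤ L ^ 2) :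
    ∃ T : Finset (TorusSite 2 L), T.card = n ∧
      ∑ k ∈ T, torusBand L k ≤
        -4 * ((L : ℝ) / Real.pi * Real.sin ((2 * h + 1 : ℕ) * Real.pi / L) +
            2 * ((L : ℝ) / Real.pi) ^ 2 * Real.sin (h * Real.pi / L) ^ 2) +
          4 * ((n - (2 * h ^ 2 + 2 * h + 1) : ℕ) : ℝ) := by
  classical
  -- the diamond `|a - h| + |b - h| ≤ h` inside `[0, 2h]²`, and its rows
  obtain ⟨D, hD⟩ : ∃ D : Finset (ℕ × ℕ), D =
      ((Finset.range (2 * h + 1)) ×ˢ (Finset.range (2 * h + 1))).filter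
        (fun p : ℕ × ℕ => h ≤ p.1 + p.2 ∧ p.1 + p.2 ≤ 3 * h ∧ p.1 ≤ p.2 + h ∧ p.2 ≤ p.1 + h) :=
    ⟨_, rfl⟩
  have hfib : ∀ p : ℕ × ℕ, p ∈ D ↔ p.1 ∈ Finset.range (2 * h + 1) ∧
      p.2 ∈ Finset.Ico (h - min p.1 (2 * h - p.1))
        (h - min p.1 (2 * h - p.1) + (2 * min p.1 (2 * h - p.1) + 1)) := by
    intro p
    simp only [hD, Finset.mem_filter, Finset.mem_product, Finset.mem_range, Finset.mem_Ico]
    omega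
  have hDcard : D.card = 2 * h ^ 2 + 2 * h + 1 := by
    rw [Finset.card_eq_sum_ones, Finset.sum_finset_product D (Finset.range (2 * h + 1))
      (fun a => Finset.Ico (h - min a (2 * h - a)) (h - min a (2 * h - a) + (2 * min a (2 * h - a) + 1)))
      hfib]
    have hrow : ∀ a ∈ Finset.range (2 * h + 1),
        ∑ _b ∈ Finset.Ico (h - min a (2 * h - a)) (h - min a (2 * h - a) + (2 * min a (2 * h - a) + 1)),
          (1 : ℕ) = 2 * min a (2 * h - a) + 1 := by
      intro a _
      rw [Finset.sum_const, smul_eq_mul, mul_one, Nat.card_Ico, Nat.add_sub_cancel_left]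
    rw [Finset.sum_congr rfl hrow, sum_range_two_mul_add_one_min (fun j => 2 * j + 1) h,
      sum_range_two_mul_add_one]
    ring
  -- the torus points of the diamond: distinct residues since `2h + 1 ≤ L`
  obtain ⟨pt, hpt⟩ : ∃ pt : ℕ × ℕ → TorusSite 2 L, pt = fun p =>
      ![((p.1 : ℕ) : ZMod L) - ((h : ℕ) : ZMod L), ((p.2 : ℕ) : ZMod L) - ((h : ℕ) : ZMod L)] :=
    ⟨_, rfl⟩
  have hinj : Set.InjOn pt ↑D := by
    intro p hp q hq hpq
    have hp' : p.1 < 2 * h + 1 ∧ p.2 < 2 * h + 1 := by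
      have := hp
      simp only [Finset.mem_coe, hD, Finset.mem_filter, Finset.mem_product, Finset.mem_range] at this
      exact this.1
    have hq' : q.1 < 2 * h + 1 ∧ q.2 < 2 * h + 1 := by
      have := hq
      simp only [Finset.mem_coe, hD, Finset.mem_filter, Finset.mem_product, Finset.mem_range] at this
      exact this.1
    have key : ∀ a b : ℕ, a < L → b < L →
        ((a : ℕ) : ZMod L) - ((h : ℕ) : ZMod L) = ((b : ℕ) : ZMod L) - ((h : ℕ) : ZMod L) → a = b := by
      intro a b ha hb hab
      rw [sub_left_inj] at hab
      have := (ZMod.natCast_eq_natCast_iff' a b L).1 hab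
      rwa [Nat.mod_eq_of_lt ha, Nat.mod_eq_of_lt hb] at this
    have h0 := congrFun hpq 0
    have h1 := congrFun hpq 1
    simp only [hpt, Matrix.cons_val_zero, Matrix.cons_val_one] at h0 h1
    exact Prod.ext (key _ _ (by omega) (by omega) h0) (key _ _ (by omega) (by omega) h1)
  -- the band energy at a diamond point, as integer cosines
  have hband : ∀ p : ℕ × ℕ, torusBand L (pt p) =
      -2 * (Real.cos (2 * Real.pi * ((p.1 : ℝ) - h) / L) +
        Real.cos (2 * Real.pi * ((p.2 : ℝ) - h) / L)) := by
    intro p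
    have e : ∀ u : ℕ,
        ((u : ℕ) : ZMod L) - ((h : ℕ) : ZMod L) = ((((u : ℕ) : ℤ) - (h : ℤ) : ℤ) : ZMod L) := by
      intro u
      push_cast
      ring
    unfold torusBand
    rw [Fin.sum_univ_two, latticeMomentum_apply, latticeMomentum_apply]
    simp only [hpt, Matrix.cons_val_zero, Matrix.cons_val_one]
    rw [e, e, cos_two_pi_intCast_val_div, cos_two_pi_intCast_val_div]
    push_cast
    ring
  -- `a ↔ b` symmetry of the diamond
  have hsymm : ∑ p ∈ D, Real.cos (2 * Real.pi * ((p.1 : ℝ) - h) / L) =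
      ∑ p ∈ D, Real.cos (2 * Real.pi * ((p.2 : ℝ) - h) / L) := by
    refine Finset.sum_equiv (Equiv.prodComm ℕ ℕ) (fun p => ?_) (fun p _ => rfl)
    simp only [hD, Equiv.prodComm_apply, Prod.fst_swap, Prod.snd_swap, Finset.mem_filter,
      Finset.mem_product, Finset.mem_range]
    omega
  -- row by row: each row is a Dirichlet sum `D_{w_a}`
  have hrows : ∑ p ∈ D, Real.cos (2 * Real.pi * ((p.2 : ℝ) - h) / L) =
      ∑ a ∈ Finset.range (2 * h + 1), ∑ u ∈ Finset.range (2 * min a (2 * h - a) + 1),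
        Real.cos (2 * Real.pi * ((u : ℝ) - (min a (2 * h - a) : ℕ)) / L) := by
    rw [Finset.sum_finset_product D (Finset.range (2 * h + 1))
      (fun a => Finset.Ico (h - min a (2 * h - a)) (h - min a (2 * h - a) + (2 * min a (2 * h - a) + 1)))
      hfib]
    refine Finset.sum_congr rfl fun a _ => ?_
    exact sum_Ico_cos_shift L (by omega)
  have hR := sum_range_two_mul_add_one_min
    (fun j => ∑ u ∈ Finset.range (2 * j + 1), Real.cos (2 * Real.pi * ((u : ℝ) - j) / L)) h
  have hA := dirichlet_sum_lower hL h hm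
  have hB := sq_mul_sin_sq_le_sum_dirichlet_sum hL h
  have hDsum : ∑ p ∈ D, torusBand L (pt p) ≤
      -4 * ((L : ℝ) / Real.pi * Real.sin ((2 * h + 1 : ℕ) * Real.pi / L) +
        2 * ((L : ℝ) / Real.pi) ^ 2 * Real.sin (h * Real.pi / L) ^ 2) := by
    simp_rw [hband]
    rw [← Finset.mul_sum, Finset.sum_add_distrib, hsymm, hrows, hR]
    linarith
  -- the image in the torus, padded with `n - (2h² + 2h + 1)` arbitrary further momenta
  set T₀ : Finset (TorusSite 2 L) := D.image pt with hT₀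
  have hT₀card : T₀.card = 2 * h ^ 2 + 2 * h + 1 := by
    rw [hT₀, Finset.card_image_of_injOn hinj, hDcard]
  have hT₀sum : ∑ k ∈ T₀, torusBand L k ≤
      -4 * ((L : ℝ) / Real.pi * Real.sin ((2 * h + 1 : ℕ) * Real.pi / L) +
        2 * ((L : ℝ) / Real.pi) ^ 2 * Real.sin (h * Real.pi / L) ^ 2) := by
    rw [hT₀, Finset.sum_image hinj]
    exact hDsum
  have huniv : (Finset.univ : Finset (TorusSite 2 L)).card = L ^ 2 := by
    simp [Finset.card_univ, Fintype.card_pi, ZMod.card]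
  have hroom : n - (2 * h ^ 2 + 2 * h + 1) ≤ (Finset.univ \ T₀).card := by
    rw [Finset.card_sdiff_of_subset (Finset.subset_univ _), huniv, hT₀card]
    omega
  obtain ⟨X, hXsub, hXcard⟩ := Finset.exists_subset_card_eq hroom
  have hdisj : Disjoint T₀ X := by
    rw [Finset.disjoint_iff_ne]
    rintro a ha b hb rfl
    exact (Finset.mem_sdiff.1 (hXsub hb)).2 ha
  refine ⟨T₀ ∪ X, ?_, ?_⟩
  · rw [Finset.card_union_of_disjoint hdisj, hT₀card, hXcard]
    omega
  · rw [Finset.sum_union hdisj]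
    have hX : ∑ k ∈ X, torusBand L k ≤ 4 * ((n - (2 * h ^ 2 + 2 * h + 1) : ℕ) : ℝ) := by
      calc ∑ k ∈ X, torusBand L k ≤ ∑ _k ∈ X, (4 : ℝ) :=
            Finset.sum_le_sum fun k _ => torusBand_le_four L k
        _ = 4 * ((n - (2 * h ^ 2 + 2 * h + 1) : ℕ) : ℝ) := by
            rw [Finset.sum_const, hXcard, nsmul_eq_mul]
            ring
    linarith

/-- Registered sub-goal form (line `redirect_birth`, lead c11, wave 3): the `n`-element trial momentum set
built on the centred diamond, all parameters explicit (`exists_diamondTrialSet_card_eq`). [folklore] -/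
theorem existsDiamondTrialSet : ∀ {L : ℕ} [NeZero L], 3 ≤ L → ∀ (h : ℕ), 2 * h + 1 ≤ L → ∀ {n : ℕ}, 2 * h ^ 2 + 2 * h + 1 ≤ n → n ≤ L ^ 2 → ∃ T : Finset (TorusSite 2 L), T.card = n ∧ ∑ k ∈ T, torusBand L k ≤ -4 * ((L : ℝ) / Real.pi * Real.sin ((2 * h + 1 : ℕ) * Real.pi / L) + 2 * ((L : ℝ) / Real.pi) ^ 2 * Real.sin (h * Real.pi / L) ^ 2) + 4 * ((n - (2 * h ^ 2 + 2 * h + 1) : ℕ) : ℝ) :=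
  fun hL h hm _ hn hnL => exists_diamondTrialSet_card_eq hL h hm hn hnL

/-! ### The diamond sea in the exact-doublon Stoner ceilings -/

/-- **Band-edge Stoner ceiling with the diamond sea**: for `L ≥ 3`, `0 ≤ U`, a ground state `ψ` of the
`(2n, S^z = 0)` sector of `hubbardTorus 2 L 1 U` with `S² ψ = S(S+1) ψ`, `S ≤ n`, and `2h + 1 ≤ L`,
`2h² + 2h + 1 ≤ n ≤ L²`:
`8S ≤ 4L² - 8((L/π) sin((2h+1)π/L) + 2(L/π)² sin²(hπ/L)) + 8(n - (2h²+2h+1)) + U n²/L²`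
(`eight_spin_le_of_pairedSea_exact` with the list of `exists_diamondTrialSet_card_eq`). [folklore] -/
theorem eight_spin_le_of_diamondSea_exact (hL : 3 ≤ L) {U : ℝ} (hU : 0 ≤ U) {n S : ℕ} (hS : S ≤ n)
    {ψ : Fock (Orb (FermionTorus 2 L))} (hgs : IsGroundStateInSector (hubbardTorus 2 L 1 U) (2 * n) 0 ψ)
    (hspin : spinSq *ᵥ ψ = (((S : ℝ) * ((S : ℝ) + 1) : ℝ) : ℂ) • ψ)
    (h : ℕ) (hm : 2 * h + 1 ≤ L) (hn : 2 * h ^ 2 + 2 * h + 1 ≤ n) (hnL : n ≤ L ^ 2) :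
    8 * (S : ℝ) ≤ 4 * (L : ℝ) ^ 2 -
        8 * ((L : ℝ) / Real.pi * Real.sin ((2 * h + 1 : ℕ) * Real.pi / L) +
          2 * ((L : ℝ) / Real.pi) ^ 2 * Real.sin (h * Real.pi / L) ^ 2) +
        8 * ((n - (2 * h ^ 2 + 2 * h + 1) : ℕ) : ℝ) + U * ((n : ℝ) ^ 2 / (L : ℝ) ^ 2) := by
  obtain ⟨T, hTcard, hTsum⟩ := exists_diamondTrialSet_card_eq hL h hm hn hnL
  have hstoner := eight_spin_le_of_pairedSea_exact hL hU hS hgs hspin (Finset.nodup_toList T)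
    (by rw [Finset.length_toList, hTcard])
  rw [Finset.toList_toFinset] at hstoner
  linarith

/-- **Shifted Stoner ceiling with the diamond sea**: for `L ≥ 3`, `0 ≤ U`, `μ < t`, a ground state `ψ`
of the `(2n, S^z = 0)` sector of `hubbardTorus 2 L 1 U` with `S² ψ = S(S+1) ψ`, `S ≤ n`, and
`2h + 1 ≤ L`, `2h² + 2h + 1 ≤ n ≤ L²`:
`2μn - L²(4+t²)/(4(t-μ)) + 8((L/π) sin((2h+1)π/L) + 2(L/π)² sin²(hπ/L)) - 8(n - (2h²+2h+1)) - U n²/L²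
  ≤ (μ + 4)(n - S)`
(`shifted_spin_le_of_pairedSea_exact` with the list of `exists_diamondTrialSet_card_eq`). [folklore] -/
theorem shifted_spin_le_of_diamondSea_exact (hL : 3 ≤ L) {U : ℝ} (hU : 0 ≤ U) {n S : ℕ} (hS : S ≤ n)
    {ψ : Fock (Orb (FermionTorus 2 L))} (hgs : IsGroundStateInSector (hubbardTorus 2 L 1 U) (2 * n) 0 ψ)
    (hspin : spinSq *ᵥ ψ = (((S : ℝ) * ((S : ℝ) + 1) : ℝ) : ℂ) • ψ)
    (h : ℕ) (hm : 2 * h + 1 ≤ L) (hn : 2 * h ^ 2 + 2 * h + 1 ≤ n) (hnL : n ≤ L ^ 2)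
    {μ t : ℝ} (hμt : μ < t) :
    2 * μ * n - (L : ℝ) ^ 2 * (4 + t ^ 2) / (4 * (t - μ)) +
        8 * ((L : ℝ) / Real.pi * Real.sin ((2 * h + 1 : ℕ) * Real.pi / L) +
          2 * ((L : ℝ) / Real.pi) ^ 2 * Real.sin (h * Real.pi / L) ^ 2) -
        8 * ((n - (2 * h ^ 2 + 2 * h + 1) : ℕ) : ℝ) - U * ((n : ℝ) ^ 2 / (L : ℝ) ^ 2) ≤
      (μ + 4) * ((n : ℝ) - S) := by
  obtain ⟨T, hTcard, hTsum⟩ := exists_diamondTrialSet_card_eq hL h hm hn hnL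
  have hstoner := shifted_spin_le_of_pairedSea_exact hL hU hS hgs hspin (Finset.nodup_toList T)
    (by rw [Finset.length_toList, hTcard]) hμt
  rw [Finset.toList_toFinset] at hstoner
  linarith

end DiamondSea

end Summit.HubbardSuperconductivity.HubbardSuperconductivity.Theorems.MesoscopicPairOrder.Negative
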